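import Summits.ResolutionOfSingularities.ResolutionOfSingularities.Theorems.FrobeniusLadderFInjectiveMacaulayficationClauseLocalizesScheme
import Summits.ResolutionOfSingularities.ResolutionOfSingularities.Theorems.FrobeniusLadderFInjectiveMacaulayficationIdealSheafOfPointClosure
import Summits.ResolutionOfSingularities.ResolutionOfSingularities.Theorems.FrobeniusLadderFInjectiveMacaulayficationBlowupFiModelOfCoverOpen
import HarnessLib

/-!
# E7 N5d — level 1 of a two-level tower in STALK currency: the FULL clause at the stalks of `X′` over `b` OFF `supp J₂`
# from chart clauses off `V(J₂)` (crux `FInjectiveMacaulayfication` stmt-ResolutionOfSingularities-15315, chain w45a; E7 CERT FORMAT §2)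

[OURS · L1 W4.5a · res-L1-w45a-lead-1 gen 4] Support file (`--supports stmt-ResolutionOfSingularities-15315 --as helper`) for the
crux `FrobeniusLadder.FInjectiveMacaulayfication`; NOT a statement of any manuscript; AI-written, weaker than expert review.

THE THEOREM (`stalkClause_off_support_of_chartClauses`). `π₁ : X′ ⟶ X`, `b : X`, `J₂` an ideal sheaf on `X′` (the second centre),
`X′` locally Noetherian with characteristic-`p` stalks, and a family of affine opens `U c` of `X′` covering the fibre over `b` off
`supp J₂`, with `Γ(X′, U c)` Jacobson domains and fibre ideals `𝔟 c` (`z` over `b` ⇒ `𝔟 c ≤ 𝔭_z`, the N4 binder `h𝔟`). If on every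
chart the Cohen–Macaulay + Frobenius-closed clause holds at `Γ(X′, U c)_Q` for every MAXIMAL `Q ⊇ 𝔟 c` NOT containing `J₂(U c)`
(= what the level-1 cells «over b minus V(P_c)» certify, E7 CERT FORMAT `cover_target: over_b_minus_bad`), then the FULL clause
holds at the stalk of `X′` at EVERY point over `b` off `supp J₂` — the binder `hoffStalk` of N4′
`TwoLevelTower.twoLevelTower_good_of_suppCover`.
PROOF. For `x′` over `b` off the support, in a chart `U c ∋ x′`: `J₂(U c) ≰ 𝔭_{x′}` (support = zero locus of the chart ideal), so by
the Jacobson property some maximal `Q ⊇ 𝔭_{x′}` still avoids `J₂(U c)` (`BlowupFiModelOfCoverOpen.exists_isMaximal_le_notMem`) and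
contains `𝔟 c`; the closed point `y′ = fromSpec Q` has `𝒪_{X′,y′} ≅ Γ(X′,U c)_Q` (`IsAffineOpen.isLocalization_stalk'`), so FULL holds
at `y′`; `x′ ⤳ y′` (`𝔭_{x′} ≤ Q`, specialization inside an affine open), and the FULL clause generizes
(`ClauseLocalizes.fiClause_of_specializes`, E5 + Stacks 01J7). No named facts. [folklore]
-/

-- single-problem summit: the doubled namespace component is forced
set_option linter.dupNamespace false

noncomputable section

namespace Summit.ResolutionOfSingularities.ResolutionOfSingularities.Theorems.FInjectiveMacaulayfication.TwoLevelTowerLevelOne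

open AlgebraicGeometry CategoryTheory TopologicalSpace
open Summit.ResolutionOfSingularities.ResolutionOfSingularities.Theorems.FInjectiveMacaulayfication

/-- **E7 N5d — `hoffStalk` from chart clauses off `V(J₂)`.** See the module docstring. [folklore] -/
theorem stalkClause_off_support_of_chartClauses (p : ℕ) [Fact p.Prime] (X X' : Scheme.{0}) [IsLocallyNoetherian X']
    (π₁ : X' ⟶ X) (b : X) (J₂ : X'.IdealSheafData)
    (hcharStalk : ∀ x' : X', CharP (X'.presheaf.stalk x') p)
    {ι : Type} (U : ι → X'.affineOpens)
    (hcover : ∀ x' : X', π₁.base x' = b → x' ∉ J₂.support → ∃ c : ι, x' ∈ (U c : X'.Opens))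
    (hdom : ∀ c : ι, IsDomain Γ(X', U c)) (hjac : ∀ c : ι, IsJacobsonRing Γ(X', U c))
    (𝔟 : ∀ c : ι, Ideal Γ(X', U c))
    (h𝔟 : ∀ (c : ι) (z : ↥(Spec Γ(X', U c))), π₁.base ((U c).2.fromSpec.base z) = b → 𝔟 c ≤ z.asIdeal)
    (hchart : ∀ (c : ι) (Q : Ideal Γ(X', U c)) [Q.IsMaximal], ¬ J₂.ideal (U c) ≤ Q → 𝔟 c ≤ Q →
      ∀ d : ℕ, ringKrullDim (Localization.AtPrime Q) = d → ∀ s : Fin d → Localization.AtPrime Q,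
        (Ideal.span (Set.range s)).radical.IsMaximal →
          RingTheory.Sequence.IsWeaklyRegular (Localization.AtPrime Q) (List.ofFn s) ∧
          ∀ y : Localization.AtPrime Q, (∃ e : ℕ, y ^ p ^ e ∈ Ideal.span
            ((fun z : Localization.AtPrime Q => z ^ p ^ e) ''
              (Ideal.span (Set.range s) : Set (Localization.AtPrime Q)))) → y ∈ Ideal.span (Set.range s)) :
    ∀ x' : X', π₁.base x' = b → x' ∉ J₂.support →
      IsDomain (X'.presheaf.stalk x') ∧ ∀ d : ℕ, ringKrullDim (X'.presheaf.stalk x') = d → ∀ s : Fin d → X'.presheaf.stalk x',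
        (Ideal.span (Set.range s)).radical.IsMaximal → RingTheory.Sequence.IsWeaklyRegular (X'.presheaf.stalk x') (List.ofFn s) ∧
        ∀ y : X'.presheaf.stalk x', (∃ e : ℕ, y ^ p ^ e ∈ Ideal.span ((fun z : X'.presheaf.stalk x' => z ^ p ^ e) ''
          (Ideal.span (Set.range s) : Set (X'.presheaf.stalk x')))) → y ∈ Ideal.span (Set.range s) := by
  intro x' hx'b hx'supp
  classical
  obtain ⟨c, hx'U⟩ := hcover x' hx'b hx'supp
  haveI := hdom c
  haveI := hjac c
  set 𝔭 : ↥(Spec Γ(X', U c)) := (U c).2.primeIdealOf ⟨x', hx'U⟩ with h𝔭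
  -- `J₂(U c) ≰ 𝔭_{x′}`: otherwise `x′` lies in the zero locus of the chart ideal, i.e. in the support
  have hJ𝔭 : ¬ J₂.ideal (U c) ≤ 𝔭.asIdeal := by
    intro hle
    apply hx'supp
    rw [Scheme.IdealSheafData.mem_support_iff_of_mem (I := J₂) (U := U c) hx'U, Scheme.mem_zeroLocus_iff]
    intro g hg hxg
    -- `x′ ∈ D(g)` contradicts `g ∈ 𝔭_{x′}`
    have h1 : (U c).2.fromSpec.base 𝔭 ∈ X'.basicOpen g := by
      rw [h𝔭, (U c).2.fromSpec_primeIdealOf ⟨x', hx'U⟩]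
      exact hxg
    have h2 : 𝔭 ∈ (U c).2.fromSpec ⁻¹ᵁ X'.basicOpen g := h1
    rw [(U c).2.fromSpec_preimage_basicOpen] at h2
    exact (PrimeSpectrum.mem_basicOpen (f := g) 𝔭).mp h2 (hle hg)
  obtain ⟨u, huJ, hu𝔭⟩ : ∃ u ∈ J₂.ideal (U c), u ∉ 𝔭.asIdeal := by
    by_contra hcon
    push Not at hcon
    exact hJ𝔭 fun u hu => hcon u hu
  -- a maximal `Q ⊇ 𝔭_{x′}` still avoiding `J₂(U c)` (Jacobson)
  obtain ⟨Q, hQmax, h𝔭Q, huQ⟩ := BlowupFiModelOfCoverOpen.exists_isMaximal_le_notMem 𝔭.asIdeal hu𝔭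
  haveI := hQmax
  have hQJ : ¬ J₂.ideal (U c) ≤ Q := fun hle => huQ (hle huJ)
  -- `𝔟 c ≤ 𝔭_{x′} ≤ Q`
  have hb𝔭 : 𝔟 c ≤ 𝔭.asIdeal := by
    refine h𝔟 c 𝔭 ?_
    rw [h𝔭, (U c).2.fromSpec_primeIdealOf ⟨x', hx'U⟩]
    exact hx'b
  have hbQ : 𝔟 c ≤ Q := hb𝔭.trans h𝔭Q
  -- the closed point `y′ = fromSpec Q`
  set zQ : ↥(Spec Γ(X', U c)) := (⟨Q, hQmax.isPrime⟩ : PrimeSpectrum Γ(X', U c)) with hzQ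
  set y' : X' := (U c).2.fromSpec.base zQ with hy'
  have hy'U : y' ∈ (U c : X'.Opens) := by
    have h : y' ∈ Set.range (U c).2.fromSpec.base := ⟨zQ, rfl⟩
    rw [(U c).2.range_fromSpec] at h
    exact h
  -- `𝔭_{y′} = Q`
  have h𝔭y' : (U c).2.primeIdealOf ⟨y', hy'U⟩ = zQ := by
    apply (U c).2.fromSpec.isOpenEmbedding.injective
    rw [(U c).2.fromSpec_primeIdealOf ⟨y', hy'U⟩]
  -- FULL at `Γ(X′,U c)_Q`, hence at `𝒪_{X′,y′} ≅ Γ(X′,U c)_Q`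
  haveI : IsDomain (Localization.AtPrime Q) :=
    IsLocalization.isDomain_localization (M := Q.primeCompl) Q.primeCompl_le_nonZeroDivisors
  have hQfull : IsDomain (Localization.AtPrime Q) ∧ ∀ d : ℕ, ringKrullDim (Localization.AtPrime Q) = d →
      ∀ s : Fin d → Localization.AtPrime Q, (Ideal.span (Set.range s)).radical.IsMaximal →
        RingTheory.Sequence.IsWeaklyRegular (Localization.AtPrime Q) (List.ofFn s) ∧
        ∀ y : Localization.AtPrime Q, (∃ e : ℕ, y ^ p ^ e ∈ Ideal.span
          ((fun z : Localization.AtPrime Q => z ^ p ^ e) ''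
            (Ideal.span (Set.range s) : Set (Localization.AtPrime Q)))) → y ∈ Ideal.span (Set.range s) :=
    ⟨inferInstance, hchart c Q hQJ hbQ⟩
  letI := TopCat.Presheaf.algebra_section_stalk X'.presheaf (⟨y', hy'U⟩ : (U c : X'.Opens))
  haveI : IsLocalization.AtPrime (X'.presheaf.stalk y') zQ.asIdeal := (U c).2.isLocalization_stalk' zQ hy'U
  let e : Localization.AtPrime Q ≃+* X'.presheaf.stalk y' :=
    (IsLocalization.algEquiv Q.primeCompl (Localization.AtPrime Q) (X'.presheaf.stalk y')).toRingEquiv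
  have hy'full := fiClause_of_ringEquiv p e hQfull
  -- `x′ ⤳ y′` inside the affine open, and the clause generizes
  have hxy : x' ⤳ y' := by
    rw [specializes_iff_mem_closure,
      ← IdealSheafOfPointClosure.primeIdealOf_le_iff_mem_closure (U c) x' hx'U y' hy'U, h𝔭y', ← h𝔭]
    exact h𝔭Q
  haveI := hcharStalk y'
  exact ClauseLocalizes.fiClause_of_specializes p hxy hy'full

end Summit.ResolutionOfSingularities.ResolutionOfSingularities.Theorems.FInjectiveMacaulayfication.TwoLevelTowerLevelOne

end
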